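import Mathlib
import Summits.Ventures.PercRepro2.TypedUntouchedMarks

/-!
# The weighted faces where the covariance form vanishes identically (blind cell PercRepro2,
night-3 g5, 2026-08-25; `proofs/NIGHT3-CERT.md` §14)

The typed vanishing rules of `TypedUntouched.lean` / `TypedUntouchedMarks.lean` transported to the
weighted covariance form `Gc = D · P(Q) · G` of row 2′HCOV: for a weight vector `p` let
`zmax p := (p ≠ 0)` be the configuration with every non-closed edge open.  If no FRACTIONAL edge
of `p` (`p e ∉ {0, 1}`) touches the cluster of `a₁` — or of `a₂`, `o`, `b` — in `zmax p`, then
`Gc p = 0` (`Gc_eq_zero_of_untouched_a1` / `_a2` / `_o` / `_b`): the covariance form has no content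
on the faces of the cube on which one of the four marks has a deterministic cluster.

The bridge is the `= 0` twin of `triSum_nonneg_of_typedCount_subset` (TwoTypedEdges.lean):
`triSum_eq_zero_of_typedCount_subset` — if every typed count supported on the fractional edge set
vanishes, so does every typed sum, in particular the cubic form; the pinnings met in the
induction agree with `zmax p` off the fractional set, so the untouched cluster is the same
(`cluster_eq_of_eqOn_touches`) and the typed rules apply.
-/

namespace Summit.Ventures.PercRepro2

open UnionCluster

namespace CovForm

namespace Untouched

open OneTyped TypedA3

/-! ## The vanishing bridge -/

section Bridge

variable {E : Type*} [Fintype E] [DecidableEq E] {R : Type*} [Field R] [LinearOrder R]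
  [IsStrictOrderedRing R]

/-- **Restricted three-copy reduction, vanishing form**: if the typed counts vanish on the subsets
of `S` (at every pinning), the typed sums vanish for every weight vector pinned off `S`. -/
theorem triSum_eq_zero_of_typedCount_subset (K : Config E → Config E → Config E → R)
    (S : Finset E)
    (hcount : ∀ G : Finset E, G ⊆ S → ∀ (z : Config E) (σ : E → ℕ),
      (∀ e ∈ G, σ e = 1 ∨ σ e = 2) → typedCount G z σ K = 0)
    (p : E → R) (hS : ∀ e, e ∉ S → p e = 0 ∨ p e = 1)
    (F : Finset E) (hF : F ⊆ S) (τ : E → ℕ) (hτ : ∀ e ∈ F, τ e = 1 ∨ τ e = 2) :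
    triSum p F τ K = 0 := by
  generalize hn : (triFracFree p F).card = n
  induction n using Nat.strong_induction_on generalizing p F τ with
  | _ n ih =>
    by_cases h0 : triFracFree p F = ∅
    · have hpin : ∀ e, e ∉ F → p e = 0 ∨ p e = 1 := by
        intro e he
        by_contra hc
        rw [not_or] at hc
        have : e ∈ triFracFree p F := mem_triFracFree.mpr ⟨he, hc.1, hc.2⟩
        rw [h0] at this
        exact absurd this (Finset.notMem_empty e)
      rw [triSum_pinned_eq p F hpin τ K, hcount F hF _ τ hτ, mul_zero]
    · obtain ⟨e, he⟩ := Finset.nonempty_iff_ne_empty.mpr h0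
      have heF : e ∉ F := (mem_triFracFree.mp he).1
      have heS : e ∈ S := by
        by_contra hc
        rcases hS e hc with h | h
        · exact (mem_triFracFree.mp he).2.1 h
        · exact (mem_triFracFree.mp he).2.2 h
      have hlt : ((triFracFree p F).erase e).card < n := by
        rw [← hn]
        exact Finset.card_erase_lt_of_mem he
      have hS0 : ∀ e', e' ∉ S → Function.update p e 0 e' = 0 ∨ Function.update p e 0 e' = 1 := by
        intro e' he'
        by_cases h : e' = e
        · subst h; simp
        · rw [Function.update_of_ne h]; exact hS e' he'
      have hS1 : ∀ e', e' ∉ S → Function.update p e 1 e' = 0 ∨ Function.update p e 1 e' = 1 := by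
        intro e' he'
        by_cases h : e' = e
        · subst h; simp
        · rw [Function.update_of_ne h]; exact hS e' he'
      have hτ1 : ∀ e' ∈ insert e F, Function.update τ e 1 e' = 1 ∨ Function.update τ e 1 e' = 2 := by
        intro e' he'
        by_cases h : e' = e
        · subst h; simp
        · rw [Function.update_of_ne h]
          exact hτ e' (Finset.mem_of_mem_insert_of_ne he' h)
      have hτ2 : ∀ e' ∈ insert e F, Function.update τ e 2 e' = 1 ∨ Function.update τ e 2 e' = 2 := by
        intro e' he'
        by_cases h : e' = e
        · subst h; simp
        · rw [Function.update_of_ne h]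
          exact hτ e' (Finset.mem_of_mem_insert_of_ne he' h)
      have hF' : insert e F ⊆ S := Finset.insert_subset heS hF
      have hc0 : (triFracFree (Function.update p e 0) F).card = ((triFracFree p F).erase e).card := by
        rw [triFracFree_update p F e 0 (Or.inl rfl)]
      have hc1 : (triFracFree (Function.update p e 1) F).card = ((triFracFree p F).erase e).card := by
        rw [triFracFree_update p F e 1 (Or.inr rfl)]
      have hc2 : (triFracFree p (insert e F)).card = ((triFracFree p F).erase e).card := by
        rw [triFracFree_insert]
      have h1 : triSum (Function.update p e 0) F τ K = 0 := ih _ hlt _ hS0 F hF τ hτ hc0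
      have h2 : triSum (Function.update p e 1) F τ K = 0 := ih _ hlt _ hS1 F hF τ hτ hc1
      have h3 : triSum p (insert e F) (Function.update τ e 1) K = 0 :=
        ih _ hlt _ hS (insert e F) hF' _ hτ1 hc2
      have h4 : triSum p (insert e F) (Function.update τ e 2) K = 0 :=
        ih _ hlt _ hS (insert e F) hF' _ hτ2 hc2
      rw [triSum_pin p heF τ K, h1, h2, h3, h4]
      ring

end Bridge

/-! ## The maximal configuration of a weight vector and the untouched clusters -/

section Zmax

variable {V : Type*} {E : Type*} [Fintype E] [DecidableEq E] {R : Type*} [Field R]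
  [LinearOrder R] [IsStrictOrderedRing R]

/-- The configuration with every non-closed edge open. -/
noncomputable def zmax (p : E → R) : Config E := fun e => decide (p e ≠ 0)

/-- The fractional edge set of `p`. -/
noncomputable def fracSet (p : E → R) : Finset E := Finset.univ.filter fun e => p e ≠ 0 ∧ p e ≠ 1

omit [Fintype E] [DecidableEq E] in
/-- A pinned configuration of a weight vector that is `0/1` off `S` agrees with `zmax p` off `S`
whenever it agrees with `p` off `S`. -/
lemma pinnedConfig_eq_zmax_of_ne {p q : E → R} {S : Finset E} (hpq : ∀ e, e ∉ S → q e = p e)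
    (hS : ∀ e, e ∉ S → p e = 0 ∨ p e = 1) {e : E} (he : e ∉ S) :
    pinnedConfig q e = zmax p e := by
  unfold pinnedConfig zmax
  rw [hpq e he]
  rcases hS e he with h | h
  · simp [h]
  · simp [h]

omit [Fintype E] [DecidableEq E] [IsStrictOrderedRing R] in
/-- If no edge of `S` touches the cluster of `v` in `zmax p`, then no subset `G ⊆ S` touches the
cluster of `v` in any configuration agreeing with `zmax p` off `S`. -/
lemma untouchedBy_of_zmax (ends : E → Sym2 V) {p : E → R} {S : Finset E} {v : V}
    (h : ∀ e ∈ S, e ∉ touches ends (cluster ends (zmax p) v)) {z : Config E}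
    (hz : ∀ e, e ∉ S → z e = zmax p e) {G : Finset E} (hG : G ⊆ S) : UntouchedBy ends G z v := by
  have hc : cluster ends z v = cluster ends (zmax p) v :=
    cluster_eq_of_eqOn_touches (ω := zmax p) (ω' := z)
      (fun e he => (hz e (fun heS => h e heS he)).symm) rfl
  intro e heG
  rw [hc]
  exact h e (hG heG)

omit [DecidableEq E] [IsStrictOrderedRing R] in
/-- Off the fractional set a weight vector is `0` or `1`. -/
lemma zero_or_one_of_notMem_fracSet {p : E → R} {e : E} (he : e ∉ fracSet p) :
    p e = 0 ∨ p e = 1 := by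
  unfold fracSet at he
  simp only [Finset.mem_filter, Finset.mem_univ, true_and, not_and, not_not] at he
  by_cases h : p e = 0
  · exact Or.inl h
  · exact Or.inr (he h)

end Zmax

/-! ## The weighted vanishing theorems -/

section Main

open Classical

variable {V : Type*} {E : Type*} [Fintype E] [DecidableEq E] {R : Type*} [Field R]
  [LinearOrder R] [IsStrictOrderedRing R]
variable (ends : E → Sym2 V) (o a₁ a₂ a₃ b : V)

/-- **`Gc` vanishes when the typed counts on the fractional set vanish.** -/
theorem Gc_eq_zero_of_typedCount_fracSet (p : E → R)
    (hcount : ∀ G : Finset E, G ⊆ fracSet p → ∀ (z : Config E) (σ : E → ℕ),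
      (∀ e ∈ G, σ e = 1 ∨ σ e = 2) →
        typedCount G z σ (K3 ends o a₁ a₂ a₃ b : Config E → Config E → Config E → R) = 0) :
    Gc p ends o a₁ a₂ a₃ b = 0 := by
  rw [hcov_cubic p ends o a₁ a₂ a₃ b (fun _ => 0)]
  exact triSum_eq_zero_of_typedCount_subset (K3 ends o a₁ a₂ a₃ b) (fracSet p) hcount p
    (fun e he => zero_or_one_of_notMem_fracSet he) ∅ (Finset.empty_subset _) (fun _ => 0)
    (fun e he => absurd he (Finset.notMem_empty e))

/-- The typed counts met by the reduction vanish when a mark's `zmax`-cluster is untouched by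
the fractional edges and the typed rule for that mark holds. -/
theorem Gc_eq_zero_of_untouched_rule (p : E → R) (v : V)
    (hrule : ∀ (G : Finset E) (z : Config E) (σ : E → ℕ), (∀ e ∈ G, σ e = 1 ∨ σ e = 2) →
      UntouchedBy ends G z v →
        typedCount G z σ (K3 ends o a₁ a₂ a₃ b : Config E → Config E → Config E → R) = 0)
    (h : ∀ e ∈ fracSet p, e ∉ touches ends (cluster ends (zmax p) v)) :
    Gc p ends o a₁ a₂ a₃ b = 0 := by
  rw [hcov_cubic p ends o a₁ a₂ a₃ b (fun _ => 0)]
  -- the induction of the bridge, with the invariant «`q` agrees with `p` off the fractional set»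
  suffices key : ∀ (q : E → R), (∀ e, e ∉ fracSet p → q e = p e) →
      ∀ (F : Finset E), F ⊆ fracSet p → ∀ (τ : E → ℕ), (∀ e ∈ F, τ e = 1 ∨ τ e = 2) →
        triSum q F τ (K3 ends o a₁ a₂ a₃ b) = 0 by
    exact key p (fun _ _ => rfl) ∅ (Finset.empty_subset _) (fun _ => 0)
      (fun e he => absurd he (Finset.notMem_empty e))
  intro q hq F hF τ hτ
  generalize hn : (triFracFree q F).card = n
  induction n using Nat.strong_induction_on generalizing q F τ with
  | _ n ih =>
    by_cases h0 : triFracFree q F = ∅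
    · have hpin : ∀ e, e ∉ F → q e = 0 ∨ q e = 1 := by
        intro e he
        by_contra hc
        rw [not_or] at hc
        have : e ∈ triFracFree q F := mem_triFracFree.mpr ⟨he, hc.1, hc.2⟩
        rw [h0] at this
        exact absurd this (Finset.notMem_empty e)
      rw [triSum_pinned_eq q F hpin τ _]
      have hz : ∀ e, e ∉ fracSet p → pinnedConfig q e = zmax p e := fun e he =>
        pinnedConfig_eq_zmax_of_ne hq (fun e' he' => zero_or_one_of_notMem_fracSet he') he
      rw [hrule F (pinnedConfig q) τ hτ (untouchedBy_of_zmax ends h hz hF), mul_zero]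
    · obtain ⟨e, he⟩ := Finset.nonempty_iff_ne_empty.mpr h0
      have heF : e ∉ F := (mem_triFracFree.mp he).1
      have heS : e ∈ fracSet p := by
        by_contra hc
        have hqe : q e = p e := hq e hc
        rcases zero_or_one_of_notMem_fracSet hc with h' | h'
        · exact (mem_triFracFree.mp he).2.1 (hqe.trans h')
        · exact (mem_triFracFree.mp he).2.2 (hqe.trans h')
      have hlt : ((triFracFree q F).erase e).card < n := by
        rw [← hn]
        exact Finset.card_erase_lt_of_mem he
      have hq0 : ∀ e', e' ∉ fracSet p → Function.update q e 0 e' = p e' := by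
        intro e' he'
        have hne : e' ≠ e := fun hh => he' (hh ▸ heS)
        rw [Function.update_of_ne hne]; exact hq e' he'
      have hq1 : ∀ e', e' ∉ fracSet p → Function.update q e 1 e' = p e' := by
        intro e' he'
        have hne : e' ≠ e := fun hh => he' (hh ▸ heS)
        rw [Function.update_of_ne hne]; exact hq e' he'
      have hτ1 : ∀ e' ∈ insert e F, Function.update τ e 1 e' = 1 ∨ Function.update τ e 1 e' = 2 := by
        intro e' he'
        by_cases hh : e' = e
        · subst hh; simp
        · rw [Function.update_of_ne hh]
          exact hτ e' (Finset.mem_of_mem_insert_of_ne he' hh)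
      have hτ2 : ∀ e' ∈ insert e F, Function.update τ e 2 e' = 1 ∨ Function.update τ e 2 e' = 2 := by
        intro e' he'
        by_cases hh : e' = e
        · subst hh; simp
        · rw [Function.update_of_ne hh]
          exact hτ e' (Finset.mem_of_mem_insert_of_ne he' hh)
      have hF' : insert e F ⊆ fracSet p := Finset.insert_subset heS hF
      have hc0 : (triFracFree (Function.update q e 0) F).card =
          ((triFracFree q F).erase e).card := by
        rw [triFracFree_update q F e 0 (Or.inl rfl)]
      have hc1 : (triFracFree (Function.update q e 1) F).card =
          ((triFracFree q F).erase e).card := by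
        rw [triFracFree_update q F e 1 (Or.inr rfl)]
      have hc2 : (triFracFree q (insert e F)).card = ((triFracFree q F).erase e).card := by
        rw [triFracFree_insert]
      have h1 := ih _ hlt _ hq0 F hF τ hτ hc0
      have h2 := ih _ hlt _ hq1 F hF τ hτ hc1
      have h3 := ih _ hlt _ hq (insert e F) hF' _ hτ1 hc2
      have h4 := ih _ hlt _ hq (insert e F) hF' _ hτ2 hc2
      rw [triSum_pin q heF τ _, h1, h2, h3, h4]
      ring

/-- **The covariance form vanishes when the fractional edges avoid the cluster of `a₁`** in the
configuration with every non-closed edge open. -/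
theorem Gc_eq_zero_of_untouched_a1 (p : E → R)
    (h : ∀ e ∈ fracSet p, e ∉ touches ends (cluster ends (zmax p) a₁)) :
    Gc p ends o a₁ a₂ a₃ b = 0 :=
  Gc_eq_zero_of_untouched_rule ends o a₁ a₂ a₃ b p a₁
    (fun G z σ hσ hu => typedCount_eq_zero_of_untouched_a1 ends o a₁ a₂ a₃ b G z σ hσ hu) h

/-- **… the cluster of `a₂`.** -/
theorem Gc_eq_zero_of_untouched_a2 (p : E → R)
    (h : ∀ e ∈ fracSet p, e ∉ touches ends (cluster ends (zmax p) a₂)) :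
    Gc p ends o a₁ a₂ a₃ b = 0 :=
  Gc_eq_zero_of_untouched_rule ends o a₁ a₂ a₃ b p a₂
    (fun G z σ hσ hu => typedCount_eq_zero_of_untouched_a2 ends o a₁ a₂ a₃ b G z σ hσ hu) h

/-- **… the cluster of `o`.** -/
theorem Gc_eq_zero_of_untouched_o (p : E → R)
    (h : ∀ e ∈ fracSet p, e ∉ touches ends (cluster ends (zmax p) o)) :
    Gc p ends o a₁ a₂ a₃ b = 0 :=
  Gc_eq_zero_of_untouched_rule ends o a₁ a₂ a₃ b p o
    (fun G z σ hσ hu => typedCount_eq_zero_of_untouched_o ends o a₁ a₂ a₃ b G z σ hσ hu) h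

/-- **… the cluster of `b`.** -/
theorem Gc_eq_zero_of_untouched_b (p : E → R)
    (h : ∀ e ∈ fracSet p, e ∉ touches ends (cluster ends (zmax p) b)) :
    Gc p ends o a₁ a₂ a₃ b = 0 :=
  Gc_eq_zero_of_untouched_rule ends o a₁ a₂ a₃ b p b
    (fun G z σ hσ hu => typedCount_eq_zero_of_untouched_b ends o a₁ a₂ a₃ b G z σ hσ hu) h

end Main

end Untouched

end CovForm

end Summit.Ventures.PercRepro2
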